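import Summits.ResolutionOfSingularities.ResolutionOfSingularities.Theorems.FrobeniusClosingSteerNonRationalWindowBiConeFrame
import Summits.ResolutionOfSingularities.ResolutionOfSingularities.Theorems.FrobeniusClosingSteerNonRationalWindowBiConeDedekind
import Summits.ResolutionOfSingularities.ResolutionOfSingularities.Theorems.FrobeniusClosingSteerNonRationalWindowBiConeWords
import Mathlib.FieldTheory.IsAlgClosed.AlgebraicClosure
import Mathlib.RingTheory.Jacobson.Ring
import Mathlib.LinearAlgebra.Dual.Lemmas
import HarnessLib

/-!
# Crux `Steer` (stmt-ResolutionOfSingularities-16345), chain W4.1 — **the BI-CONE LEMMA `NonRationalWindow.BiCone` HOLDS** (+ `BiConeQuadratic`)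

OURS (campaign `res-hironaka`, rung L ★L-G4, slot W4.1; word = res-L0-w41-strat-2's `NRA/BiCone_sketch_v2.lean` ec6f32d705514353, tree
`…NonRationalWindowBiConeWords`; route `NRA/BiCone-PROOF-ROUTE.md` 7e57beb60ac2f3f0 (descent-free) with the homogeneity-SCALING rigidity of FILE 1; seat
res-D-pv-053 g9 on res-L0-w41-plan-1 RULING 286 (d) / 288 (4); reader res-L0-w41-tri-1 v6.51). Candidates, not facts; nothing here is a statement of H. Hironakaʼs
manuscript [Hironaka2017] (status: under review). AI-written; AI review is weaker than expert review. Definition-free.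

PROOF. `L := k[X]/𝔮` is a finite separable extension of the PERFECT field `k` (separability is where perfectness is load-bearing: the Dedekind dual of FILE 2
needs `[L : k]` embeddings into `K := L̄`; for imperfect `k` and `L = k(a^{1/p})` there is one embedding and the lemma fails). FRAME: a maximal `J ⊆ Fin n`
with `{1} ∪ {τ_j : j ∈ J}` `k`-independent in `L` (`τ_i` = class of `X_i`); for `i ∉ J`, `τ_i = c_i + Σ_{j∈J} a_ij τ_j`, so `λ_i := X_i − c_i − Σ a_ij X_j ∈ 𝔮`;
`J ≠ ∅` by non-rationality. VERTICES: for each embedding `ψ`, `g ∈ 𝔮^d` with `deg g ≤ d` makes `g_K(X + ψτ)` a form of degree `d` (FILE 1). RIGIDITY (FILE 1):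
`g_K` is invariant under the line through any two vertices. SPAN (FILE 2): the differences of vertices span the frame directions `v_j` (a `K`-functional killing
their free parts gives a `K`-relation `Σ c_j ψ(τ_j) = b` for all `ψ`, excluded by the Dedekind dual on the independent family `(1, τ_J)`). READ-OFF (FILE 3): the
re-coordinatised `Ψ g` forgets the free variables and is a form of degree `d`; `H := (Ψ g)(X_J := 0)` in the `m := n − |J|` bound variables, `lam := (λ_i)_{i∉J}`,
`g = Φ (Ψ g) = H(λ)`. Edge `m = 0` (all indices free) is allowed: then `H` is a degree-`d` form in no variables and `g = 0` for `d ≥ 1`. [folklore]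
-/

noncomputable section

-- `Summit.<S>.<S>.…` duplicates the summit name by design (single-problem summit).
set_option linter.dupNamespace false

open MvPolynomial Module

namespace Summit.ResolutionOfSingularities.ResolutionOfSingularities.Theorems.SwitchingDichotomy.NonRationalWindow

open BiConeForms BiConeFrame BiConeDedekind

/-! ## §1 The frame theorem (both words are read off it) -/

/-- **The frame theorem.** For a perfect field `k`, a maximal ideal `𝔮 ⊂ k[X_1..X_n]` and `g ∈ 𝔮^d` of total degree `≤ d`: there are a finset `J` of FREE
indices with `{1} ∪ {τ_j : j ∈ J}` `k`-linearly independent in `k[X]/𝔮` and every `τ_i` in `span_k{1, τ_J}`, affine forms `λ_i = X_i − c_i − Σ_{j∈J} a_ij X_j ∈ 𝔮`,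
and a form `H` of degree `d` in the `m = n − |J|` bound variables with `g = H(λ)`. [folklore] -/
theorem exists_frame (k : Type) [Field k] [PerfectField k] (n : ℕ) (𝔮 : Ideal (MvPolynomial (Fin n) k)) [𝔮.IsMaximal]
    (g : MvPolynomial (Fin n) k) (d : ℕ) (hdeg : g.totalDegree ≤ d) (hg : g ∈ 𝔮 ^ d) :
    ∃ (J : Finset (Fin n)) (a : Fin n → Fin n → k) (c : Fin n → k),
      LinearIndependent k (fun o : Option J => Option.casesOn' o (1 : (MvPolynomial (Fin n) k ⧸ 𝔮)) fun j => Ideal.Quotient.mk 𝔮 (X (j : Fin n))) ∧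
      (∀ i, Ideal.Quotient.mk 𝔮 (X i) ∈ Submodule.span k (insert (1 : (MvPolynomial (Fin n) k ⧸ 𝔮)) ((fun j : Fin n => Ideal.Quotient.mk 𝔮 (X j)) '' (J : Set (Fin n))))) ∧
      (∀ i, (X i - C (c i) - ∑ j ∈ J, C (a i j) * X j : MvPolynomial (Fin n) k) ∈ 𝔮) ∧
      ∃ (m : ℕ) (eJ : {i : Fin n // i ∉ J} ≃ Fin m) (H : MvPolynomial (Fin m) k),
        m + J.card = n ∧ H.IsHomogeneous d ∧
        g = aeval (fun t => (X ((eJ.symm t : {i : Fin n // i ∉ J}) : Fin n) - C (c ((eJ.symm t : {i : Fin n // i ∉ J}) : Fin n)) - ∑ j ∈ J, C (a ((eJ.symm t : {i : Fin n // i ∉ J}) : Fin n) j) * X j : MvPolynomial (Fin n) k)) H := by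
  classical
  letI := Ideal.Quotient.field 𝔮
  haveI : Module.Finite k (MvPolynomial (Fin n) k ⧸ 𝔮) := finite_of_finite_type_of_isJacobsonRing k (MvPolynomial (Fin n) k ⧸ 𝔮)
  haveI : Algebra.IsSeparable k (MvPolynomial (Fin n) k ⧸ 𝔮) := Algebra.IsAlgebraic.isSeparable_of_perfectField
  let K := AlgebraicClosure (MvPolynomial (Fin n) k ⧸ 𝔮)
  let τ : Fin n → (MvPolynomial (Fin n) k ⧸ 𝔮) := fun i => Ideal.Quotient.mk 𝔮 (X i)
  -- §1a the frame: `J` maximal with `τ_J` independent modulo the constants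
  let V1 : Submodule k (MvPolynomial (Fin n) k ⧸ 𝔮) := Submodule.span k {(1 : (MvPolynomial (Fin n) k ⧸ 𝔮))}
  obtain ⟨Js, hJind, hJmax⟩ := exists_maximal_linearIndepOn k (V1.mkQ ∘ τ)
  let J : Finset (Fin n) := Js.toFinset
  have hJ : ∀ i, i ∈ J ↔ i ∈ Js := fun i => Set.mem_toFinset
  -- every `τ_i` is a `k`-combination of `1` and the `τ_j`, `j ∈ J`
  have hcomb : ∀ i, ∃ (l : Fin n →₀ k) (e : k), (↑l.support ⊆ Js) ∧ τ i = algebraMap k (MvPolynomial (Fin n) k ⧸ 𝔮) e + ∑ j ∈ J, l j • τ j := by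
    intro i
    have hmem : V1.mkQ (τ i) ∈ Submodule.span k ((V1.mkQ ∘ τ) '' Js) := by
      by_cases hi : i ∈ Js
      · exact Submodule.subset_span ⟨i, hi, rfl⟩
      · obtain ⟨r, hr, hri⟩ := hJmax i hi
        exact (Submodule.smul_mem_iff _ hr).mp hri
    obtain ⟨l, hl, hsum⟩ := (Finsupp.mem_span_image_iff_linearCombination k).mp hmem
    have hsum' : V1.mkQ (τ i - ∑ j ∈ J, l j • τ j) = 0 := by
      have e1 : ∑ j ∈ J, l j • τ j = l.sum fun j r => r • τ j := by
        rw [Finsupp.sum]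
        exact (Finset.sum_subset (fun j hj => (hJ j).mpr (hl hj))
          (fun j _ hj => by rw [Finsupp.notMem_support_iff.mp hj, zero_smul])).symm
      rw [map_sub, e1, ← hsum, Finsupp.linearCombination_apply, map_finsuppSum]
      simp only [Function.comp_apply, map_smul, sub_self]
    rw [Submodule.mkQ_apply, Submodule.Quotient.mk_eq_zero, Submodule.mem_span_singleton] at hsum'
    obtain ⟨e, he⟩ := hsum'
    refine ⟨l, e, hl, ?_⟩
    rw [Algebra.algebraMap_eq_smul_one, he]
    abel
  choose l c hl hτ using hcomb
  let a : Fin n → Fin n → k := fun i j => l i j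
  -- the bound affine forms lie in `𝔮`
  have hlam : ∀ i, (X i - C (c i) - ∑ j ∈ J, C (a i j) * X j : MvPolynomial (Fin n) k) ∈ 𝔮 := by
    intro i
    rw [← Ideal.Quotient.eq_zero_iff_mem]
    simp only [map_sub, map_sum, map_mul]
    change τ i - algebraMap k (MvPolynomial (Fin n) k ⧸ 𝔮) (c i) - ∑ j ∈ J, algebraMap k (MvPolynomial (Fin n) k ⧸ 𝔮) (l i j) * τ j = 0
    rw [hτ i]
    simp only [Algebra.smul_def]
    ring
  -- independence of `{1} ∪ τ_J`
  have hJind' : LinearIndependent k (fun j : J => V1.mkQ (τ (j : Fin n))) :=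
    hJind.linearIndependent.comp (fun j : J => (⟨(j : Fin n), (hJ j).mp j.2⟩ : Js))
      fun j j' hjj' => Subtype.ext (by simpa using congrArg Subtype.val hjj')
  have hind1 : LinearIndependent k (fun o : Option J => Option.casesOn' o (1 : (MvPolynomial (Fin n) k ⧸ 𝔮)) fun j => τ (j : Fin n)) := by
    rw [linearIndependent_option']
    constructor
    · exact LinearIndependent.of_comp V1.mkQ hJind'
    · intro h1
      obtain ⟨f, hf⟩ := (Submodule.mem_span_range_iff_exists_fun k).mp h1
      have h0 : ∑ j : J, f j • V1.mkQ (τ (j : Fin n)) = 0 := by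
        have h := congrArg V1.mkQ hf
        rw [map_sum] at h
        simp only [map_smul] at h
        rw [h, Submodule.mkQ_apply, Submodule.Quotient.mk_eq_zero]
        exact Submodule.mem_span_singleton_self _
      have hf0 : ∀ j, f j = 0 := Fintype.linearIndependent_iff.mp hJind' f h0
      apply one_ne_zero (α := (MvPolynomial (Fin n) k ⧸ 𝔮))
      rw [← hf]
      simp [hf0]
  have hspan1 : ∀ i, τ i ∈ Submodule.span k (insert (1 : (MvPolynomial (Fin n) k ⧸ 𝔮)) (τ '' (J : Set (Fin n)))) := by
    intro i
    rw [hτ i, Algebra.algebraMap_eq_smul_one]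
    refine Submodule.add_mem _ (Submodule.smul_mem _ _ (Submodule.subset_span (Set.mem_insert _ _)))
      (Submodule.sum_mem _ fun j hj => Submodule.smul_mem _ _ (Submodule.subset_span (Set.mem_insert_of_mem _ ⟨j, hj, rfl⟩)))
  refine ⟨J, a, c, hind1, hspan1, hlam, ?_⟩
  -- §1b the vertices: embeddings `ψ : L → K`
  let pt : ((MvPolynomial (Fin n) k ⧸ 𝔮) →ₐ[k] K) → Fin n → K := fun ψ i => ψ (τ i)
  let P : Set (Fin n → K) := Set.range pt
  have hPne : P.Nonempty := ⟨pt (IsScalarTower.toAlgHom k (MvPolynomial (Fin n) k ⧸ 𝔮) K), ⟨_, rfl⟩⟩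
  -- evaluation at a vertex factors through `ψ ∘ mk`
  have heval : ∀ (ψ : (MvPolynomial (Fin n) k ⧸ 𝔮) →ₐ[k] K) (f : MvPolynomial (Fin n) k), eval (pt ψ) (map (algebraMap k K) f) = ψ (Ideal.Quotient.mk 𝔮 f) := by
    intro ψ f
    rw [eval_map, ← aeval_def]
    have h1 : aeval (pt ψ) f = ψ (aeval τ f) := by rw [← comp_aeval_apply]
    rw [h1]
    congr 1
    have h2 : (aeval τ : MvPolynomial (Fin n) k →ₐ[k] (MvPolynomial (Fin n) k ⧸ 𝔮)) = Ideal.Quotient.mkₐ k 𝔮 := (mkₐ_eq_aeval 𝔮).symm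
    rw [h2]
    rfl
  -- (hvert) each `g_K(X + p)` is a form of degree `d`
  have hvert : ∀ p ∈ P, (bind₁ (fun i => X i + C (p i)) (map (algebraMap k K) g)).IsHomogeneous d := by
    rintro _ ⟨ψ, rfl⟩
    apply isHomogeneous_of_mem_pow_idealOfVars
    · -- the ring map `χ = (X ↦ X + p) ∘ (k → K)` sends `𝔮` into `(X)`, hence `𝔮^d` into `(X)^d`
      let χ : MvPolynomial (Fin n) k →+* MvPolynomial (Fin n) K :=
        (bind₁ (fun i => X i + C (pt ψ i)) : MvPolynomial (Fin n) K →ₐ[K] MvPolynomial (Fin n) K).toRingHom.comp (map (algebraMap k K))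
      have hχ : Ideal.map χ 𝔮 ≤ idealOfVars (Fin n) K := by
        rw [Ideal.map_le_iff_le_comap]
        intro f hf
        rw [Ideal.mem_comap]
        have h1 : idealOfVars (Fin n) K = idealOfVars (Fin n) K ^ 1 := (pow_one _).symm
        rw [h1, mem_pow_idealOfVars_iff']
        intro x hx
        have hx0 : x = 0 := by
          by_contra h
          have : 1 ≤ x.degree := Nat.one_le_iff_ne_zero.mpr ((Finsupp.degree_eq_zero_iff x).not.mpr h)
          omega
        subst hx0
        change coeff 0 (bind₁ (fun i => X i + C (pt ψ i)) (map (algebraMap k K) f)) = 0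
        rw [← constantCoeff_eq, ← eval_zero, eval_bind₁_translate, zero_add, heval, Ideal.Quotient.eq_zero_iff_mem.mpr hf, map_zero]
      have h := Ideal.mem_map_of_mem χ hg
      rw [Ideal.map_pow] at h
      exact Ideal.pow_right_mono hχ d h
    · exact (totalDegree_bind₁_translate_le _ _).trans ((Finset.sup_mono (support_map_subset _ _)).trans hdeg)
  -- (hvan) the bound forms vanish at every vertex
  have hvan : ∀ p ∈ P, ∀ i ∉ J, p i = algebraMap k K (c i) + ∑ j ∈ J, algebraMap k K (a i j) * p j := by
    rintro _ ⟨ψ, rfl⟩ i _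
    have h := heval ψ (X i - C (c i) - ∑ j ∈ J, C (a i j) * X j : MvPolynomial (Fin n) k)
    rw [Ideal.Quotient.eq_zero_iff_mem.mpr (hlam i), map_zero] at h
    simp only [map_sub, map_sum, map_mul, map_X, map_C, eval_X, eval_C] at h
    rw [sub_sub, sub_eq_zero] at h
    exact h
  -- (hspan) the frame directions lie in the span of the differences of vertices
  have hspan : ∀ j ∈ J, (fun i => if i ∈ J then (if i = j then (1 : K) else 0) else algebraMap k K (a i j)) ∈ Submodule.span K {w : Fin n → K | ∃ p ∈ P, ∃ p' ∈ P, w = p' - p} := by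
    -- the `J`-projections of the differences span `J → K`, by the Dedekind dual
    let D : Submodule K (Fin n → K) := Submodule.span K {w : Fin n → K | ∃ p ∈ P, ∃ p' ∈ P, w = p' - p}
    let π : (Fin n → K) →ₗ[K] (J → K) := LinearMap.pi fun j : J => LinearMap.proj (j : Fin n)
    have hπD : Submodule.map π D = ⊤ := by
      by_contra hne
      obtain ⟨φ, hφ0, hφ⟩ := Submodule.exists_dual_map_eq_bot_of_lt_top (lt_top_iff_ne_top.mpr hne) inferInstance
      -- `φ` kills the projections of all differences: a `K`-relation among the `ψ(τ_j)`, constant in `ψ`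
      let ψ₀ : (MvPolynomial (Fin n) k ⧸ 𝔮) →ₐ[k] K := IsScalarTower.toAlgHom k (MvPolynomial (Fin n) k ⧸ 𝔮) K
      have hkill : ∀ ψ : (MvPolynomial (Fin n) k ⧸ 𝔮) →ₐ[k] K, φ (π (pt ψ - pt ψ₀)) = 0 := by
        intro ψ
        have hm : φ (π (pt ψ - pt ψ₀)) ∈ Submodule.map φ (Submodule.map π D) :=
          Submodule.mem_map_of_mem (Submodule.mem_map_of_mem (Submodule.subset_span ⟨pt ψ₀, ⟨ψ₀, rfl⟩, pt ψ, ⟨ψ, rfl⟩, rfl⟩))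
        rw [hφ] at hm
        exact (Submodule.mem_bot K).mp hm
      -- coefficients of `φ` on the standard basis
      let cφ : J → K := fun j => φ (Pi.single j 1)
      have hφsum : ∀ y : J → K, φ y = ∑ j, y j * cφ j := by
        intro y
        conv_lhs => rw [show y = ∑ j, y j • (Pi.single j (1 : K) : J → K) from by
          funext j'
          simp only [Finset.sum_apply, Pi.smul_apply, Pi.single_apply, smul_eq_mul, mul_ite, mul_one, mul_zero]
          rw [Finset.sum_ite_eq Finset.univ j', if_pos (Finset.mem_univ _)]]
        rw [map_sum]
        simp only [map_smul, smul_eq_mul, cφ]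
      -- the relation `Σ_j cφ_j ψ(τ_j) − b·ψ(1) = 0` with `b := Σ_j ψ₀(τ_j) cφ_j`
      let b : K := ∑ j : J, ψ₀ (τ (j : Fin n)) * cφ j
      have hrel : ∀ ψ : (MvPolynomial (Fin n) k ⧸ 𝔮) →ₐ[k] K, ∑ o : Option J,
          (Option.casesOn' o (-b) cφ) * ψ (Option.casesOn' o (1 : (MvPolynomial (Fin n) k ⧸ 𝔮)) fun j => τ (j : Fin n)) = 0 := by
        intro ψ
        have h := hkill ψ
        rw [hφsum] at h
        simp only [π, LinearMap.pi_apply, LinearMap.coe_proj, Function.eval, Pi.sub_apply, pt, sub_mul, Finset.sum_sub_distrib] at h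
        rw [Fintype.sum_option]
        simp only [Option.casesOn'_none, Option.casesOn'_some, map_one, mul_one]
        rw [sub_eq_zero] at h
        rw [neg_add_eq_sub, sub_eq_zero]
        calc ∑ j : J, cφ j * ψ (τ (j : Fin n)) = ∑ j : J, ψ (τ (j : Fin n)) * cφ j := Finset.sum_congr rfl fun j _ => mul_comm _ _
          _ = b := h
      have hzero := embedding_dual_eq_zero (k := k) (K := K) hind1 hrel
      apply hφ0
      apply LinearMap.ext
      intro y
      rw [LinearMap.zero_apply, hφsum]
      refine Finset.sum_eq_zero fun j _ => ?_
      have hj := congrFun hzero (some j)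
      simp only [Option.casesOn'_some, Pi.zero_apply] at hj
      rw [hj, mul_zero]
    -- every `w ∈ D` satisfies the frame relation `w = Σ_{j'} w_{j'} v_{j'}`
    have hDrel : ∀ w ∈ D, w = ∑ j' ∈ J, w j' • (fun i => if i ∈ J then (if i = j' then (1 : K) else 0) else algebraMap k K (a i j')) := by
      intro w hw
      induction hw using Submodule.span_induction with
      | mem w hw =>
        obtain ⟨p, hp, p', hp', rfl⟩ := hw
        funext i
        simp only [Pi.sub_apply, Finset.sum_apply, Pi.smul_apply, smul_eq_mul]
        by_cases hi : i ∈ J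
        · simp only [hi, if_true, mul_ite, mul_one, mul_zero]
          rw [Finset.sum_ite_eq J i, if_pos hi]
        · simp only [hi, if_false]
          rw [hvan p' hp' i hi, hvan p hp i hi, add_sub_add_left_eq_sub, ← Finset.sum_sub_distrib]
          exact Finset.sum_congr rfl fun j' _ => by ring
      | zero => simp
      | add w₁ w₂ _ _ h₁ h₂ =>
        conv_lhs => rw [h₁, h₂]
        rw [← Finset.sum_add_distrib]
        exact Finset.sum_congr rfl fun j' _ => by rw [Pi.add_apply, add_smul]
      | smul r w _ h =>
        conv_lhs => rw [h]
        rw [Finset.smul_sum]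
        exact Finset.sum_congr rfl fun j' _ => by rw [Pi.smul_apply, smul_eq_mul, smul_smul]
    intro j hj
    have hej : (Pi.single (⟨j, hj⟩ : J) (1 : K) : J → K) ∈ Submodule.map π D := by rw [hπD]; exact Submodule.mem_top
    obtain ⟨w, hwD, hw⟩ := hej
    have hwj : ∀ j' ∈ J, w j' = if j' = j then 1 else 0 := by
      intro j' hj'
      have h := congrFun hw ⟨j', hj'⟩
      simp only [π, LinearMap.pi_apply, LinearMap.coe_proj, Function.eval, Pi.single_apply, Subtype.mk.injEq] at h
      exact h
    have hw' := hDrel w hwD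
    rw [Finset.sum_congr rfl (fun j' hj' => by rw [hwj j' hj'])] at hw'
    simp only [ite_smul, one_smul, zero_smul, Finset.sum_ite_eq' J j, if_pos hj] at hw'
    rw [← hw']
    exact hwD
  -- §1c read-off (FILE 3)
  obtain ⟨p₀, hp₀⟩ := hPne
  have hK1 := kill_frame_eq J a c (g := g) hvert hspan
  have hK2 := isHomogeneous_frame J a c (g := g) hp₀ hvert hvan hspan
  -- the bound variables
  let m := Fintype.card {i : Fin n // i ∉ J}
  let eJ : {i : Fin n // i ∉ J} ≃ Fin m := Fintype.equivFin _
  have hmn : m + J.card = n := by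
    have h := Fintype.card_subtype_compl (fun i : Fin n => i ∈ J)
    rw [Fintype.card_fin, Fintype.card_coe] at h
    have hle : J.card ≤ n := by simpa using J.card_le_univ
    show Fintype.card {i : Fin n // i ∉ J} + J.card = n
    omega
  -- `H := (Ψ g)(X_J := 0)` in the bound variables
  let θ : Fin n → MvPolynomial (Fin m) k := fun i => if h : i ∈ J then 0 else X (eJ ⟨i, h⟩)
  refine ⟨m, eJ, aeval θ (bind₁ (fun i => if i ∈ J then X i else X i + C (c i) + ∑ j ∈ J, C (a i j) * X j) g), hmn, ?_, ?_⟩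
  · have h := hK2.aeval θ (n := 1) (fun i => by
      by_cases hi : i ∈ J
      · simp only [θ, hi, dif_pos]; exact isHomogeneous_zero _ _ _
      · simp only [θ, hi, dif_neg, not_false_eq_true]; exact isHomogeneous_X _ _)
    rwa [one_mul] at h
  · rw [aeval_eq_bind₁, aeval_eq_bind₁, ← AlgHom.comp_apply, bind₁_comp_bind₁]
    -- `(aeval lam) ∘ θ = Φ ∘ κ` on generators
    have hgen : (fun i => bind₁ (fun t : Fin m => (X ((eJ.symm t : {i : Fin n // i ∉ J}) : Fin n) - C (c ((eJ.symm t : {i : Fin n // i ∉ J}) : Fin n)) - ∑ j ∈ J, C (a ((eJ.symm t : {i : Fin n // i ∉ J}) : Fin n) j) * X j : MvPolynomial (Fin n) k)) (θ i)) =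
        fun i => bind₁ (fun i => if i ∈ J then X i else X i - C (c i) - ∑ j ∈ J, C (a i j) * X j)
          ((fun i => if i ∈ J then (0 : MvPolynomial (Fin n) k) else X i) i) := by
      funext i
      by_cases hi : i ∈ J
      · simp [θ, hi]
      · simp only [θ, hi, dif_neg, not_false_eq_true, bind₁_X_right, if_false, Equiv.symm_apply_apply]
    rw [hgen, ← bind₁_comp_bind₁, AlgHom.comp_apply, hK1, bind₁_unframe_frame]

/-- From the frame: if every class `τ_i` is a constant (no free index), the residue map `k → k[X]/𝔮` is onto. [folklore] -/
theorem algebraMap_surjective_of_span_one {k : Type} [Field k] {n : ℕ} (𝔮 : Ideal (MvPolynomial (Fin n) k)) [𝔮.IsMaximal]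
    (h : ∀ i, Ideal.Quotient.mk 𝔮 (X i) ∈ Submodule.span k ({(1 : (MvPolynomial (Fin n) k ⧸ 𝔮))} : Set (MvPolynomial (Fin n) k ⧸ 𝔮))) :
    Function.Surjective (algebraMap k (MvPolynomial (Fin n) k ⧸ 𝔮)) := by
  have hτ : ∀ i, ∃ r : k, Ideal.Quotient.mk 𝔮 (X i) = algebraMap k (MvPolynomial (Fin n) k ⧸ 𝔮) r := by
    intro i
    obtain ⟨r, hr⟩ := Submodule.mem_span_singleton.mp (h i)
    exact ⟨r, by rw [Algebra.algebraMap_eq_smul_one, hr]⟩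
  choose r hr using hτ
  intro y
  obtain ⟨f, rfl⟩ := Ideal.Quotient.mk_surjective y
  refine ⟨MvPolynomial.eval r f, ?_⟩
  have h1 : Ideal.Quotient.mk 𝔮 f = aeval (fun i => Ideal.Quotient.mk 𝔮 (X i)) f := by
    change Ideal.Quotient.mkₐ k 𝔮 f = _
    rw [mkₐ_eq_aeval]
  have h2 : (aeval (fun i => algebraMap k (MvPolynomial (Fin n) k ⧸ 𝔮) (r i)) : MvPolynomial (Fin n) k →ₐ[k] (MvPolynomial (Fin n) k ⧸ 𝔮)) = (Algebra.ofId k (MvPolynomial (Fin n) k ⧸ 𝔮)).comp (aeval r) :=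
    MvPolynomial.algHom_ext fun i => by simp
  rw [h1, show (fun i => Ideal.Quotient.mk 𝔮 (X i)) = fun i => algebraMap k (MvPolynomial (Fin n) k ⧸ 𝔮) (r i) from funext hr, h2, AlgHom.comp_apply,
    Algebra.ofId_apply]
  rfl

/-! ## §2 The words -/

/-- **W-BC · `BiCone` HOLDS.** [folklore] -/
theorem biCone_holds : BiCone := by
  intro k _ _ n 𝔮 _ hnr g d hdeg hg
  classical
  obtain ⟨J, a, c, hind, hspan, hlam, m, eJ, H, hmn, hH, hgH⟩ := exists_frame k n 𝔮 g d hdeg hg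
  -- non-rationality ⇒ `J` is non-empty ⇒ `m < n`
  have hJne : J.Nonempty := by
    by_contra hJ
    rw [Finset.not_nonempty_iff_eq_empty] at hJ
    apply hnr
    apply algebraMap_surjective_of_span_one 𝔮
    intro i
    have h := hspan i
    rwa [hJ, Finset.coe_empty, Set.image_empty, ← Set.singleton_def] at h
  refine ⟨m, fun t => (X ((eJ.symm t : {i : Fin n // i ∉ J}) : Fin n) - C (c ((eJ.symm t : {i : Fin n // i ∉ J}) : Fin n)) - ∑ j ∈ J, C (a ((eJ.symm t : {i : Fin n // i ∉ J}) : Fin n) j) * X j : MvPolynomial (Fin n) k), H, ?_, fun t => ⟨totalDegree_frameForm_le J a c _, hlam _⟩, ?_, hH, hgH⟩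
  · have := hJne.card_pos
    omega
  · simp_rw [frameForm_sub_C_coeff_zero]
    exact linearIndependent_frameLin J a (fun t => ((eJ.symm t : {i : Fin n // i ∉ J}) : Fin n))
      (fun t t' h => eJ.symm.injective (Subtype.ext h)) fun t => (eJ.symm t).2

/-- **W-BC₂ · `BiConeQuadratic` HOLDS**: `[L : k] = 2` forces exactly ONE free index (`|J| + 1 ≤ 2` by independence, `J ≠ ∅` since otherwise
`L = k·1`), so `m = n − 1`. [folklore] -/
theorem biConeQuadratic_holds : BiConeQuadratic := by
  intro k _ _ n 𝔮 _ h2 g d hdeg hg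
  classical
  obtain ⟨J, a, c, hind, hspan, hlam, m, eJ, H, hmn, hH, hgH⟩ := exists_frame k n 𝔮 g d hdeg hg
  haveI : Module.Finite k (MvPolynomial (Fin n) k ⧸ 𝔮) := Module.finite_of_finrank_pos (by omega)
  have hcard : Fintype.card (Option J) ≤ 2 := by
    rw [← h2]
    exact hind.fintype_card_le_finrank
  rw [Fintype.card_option, Fintype.card_coe] at hcard
  have hJ1 : 1 ≤ J.card := by
    by_contra h0
    have hJ : J = ∅ := Finset.card_eq_zero.mp (by omega)
    have hsurj : Function.Surjective (algebraMap k (MvPolynomial (Fin n) k ⧸ 𝔮)) := by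
      apply algebraMap_surjective_of_span_one 𝔮
      intro i
      have h := hspan i
      rwa [hJ, Finset.coe_empty, Set.image_empty, ← Set.singleton_def] at h
    -- then `L = span{1}` has rank ≤ 1
    have htop : (⊤ : Submodule k (MvPolynomial (Fin n) k ⧸ 𝔮)) ≤ Submodule.span k {(1 : (MvPolynomial (Fin n) k ⧸ 𝔮))} := by
      intro y _
      obtain ⟨r, rfl⟩ := hsurj y
      rw [Algebra.algebraMap_eq_smul_one]
      exact Submodule.smul_mem _ _ (Submodule.mem_span_singleton_self _)
    have hr := Submodule.finrank_mono htop
    rw [finrank_top, h2] at hr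
    have h1 : finrank k (Submodule.span k ({(1 : (MvPolynomial (Fin n) k ⧸ 𝔮))} : Set (MvPolynomial (Fin n) k ⧸ 𝔮))) ≤ 1 :=
      (finrank_span_le_card ({(1 : (MvPolynomial (Fin n) k ⧸ 𝔮))} : Set (MvPolynomial (Fin n) k ⧸ 𝔮))).trans (by simp)
    omega
  have hm : m = n - 1 := by omega
  subst hm
  refine ⟨fun t => (X ((eJ.symm t : {i : Fin n // i ∉ J}) : Fin n) - C (c ((eJ.symm t : {i : Fin n // i ∉ J}) : Fin n)) - ∑ j ∈ J, C (a ((eJ.symm t : {i : Fin n // i ∉ J}) : Fin n) j) * X j : MvPolynomial (Fin n) k), H, fun t => ⟨totalDegree_frameForm_le J a c _, hlam _⟩, ?_, hH, hgH⟩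
  simp_rw [frameForm_sub_C_coeff_zero]
  exact linearIndependent_frameLin J a (fun t => ((eJ.symm t : {i : Fin n // i ∉ J}) : Fin n))
    (fun t t' h => eJ.symm.injective (Subtype.ext h)) fun t => (eJ.symm t).2

end Summit.ResolutionOfSingularities.ResolutionOfSingularities.Theorems.SwitchingDichotomy.NonRationalWindow

end
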